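import Mathlib
import Summits.NavierStokesRegularity.FluidComputer.TransportGalerkinExistence
import Summits.NavierStokesRegularity.FluidComputer.TransportGalerkinAbcFinal
import Summits.NavierStokesRegularity.FluidComputer.TransportGalerkinAbcKillFinal
import HarnessLib

/-!
# Galerkin limit of the transport model, XVIII: the forced-ABC KEEP / KILL words as statements about THE solution (instab g20, cell `ns-blowup`, 2026-08-27)

HONEST FRAMING (human ruling D-0035): nothing here is a claim about Navier–Stokes blow-up.
WHAT THIS IS NOT: not NS — a MODEL theorem schema about the forced-ABC perturbation equation on
`𝕋³`; its load-bearing inputs are the Lyapunov certificates of record (interval stage not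
commissioned) and, for KEEP, the certified X0 eigenvalue; no number or census word moves.

PURPOSE. g19's entry points `TransportGalerkinAbcFinal.exists_keep_eigenvector_abc_final` (KEEP: from
`Torus.IsLinNSEigenvalue ν (abcFlow A B C) μ`, `μ ≥ 0`, `ν > 0`, and the certificates at levels `≥ K`,
the floor `ε e^{μt}/2 ≤ ‖w t‖`) and `TransportGalerkinAbcKillFinal.decay_two_abc_final` (KILL: from the
certificates and the basin data, `‖w t‖ ≤ 2 ε e^{λt}`) conclude for EVERY classical solution `w` of the
model from the seed read in the class with a uniform polynomial tail of scaled order `6` (+ the three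
linear clauses) — sentences that are vacuous unless such a `w` exists. THIS FILE: under exactly the same
hypotheses the model HAS a classical solution `w` on the whole window `[0, T]` from the seed in that
class, it obeys the floor (`exists_keep_solution_abc_final`) / the decay (`exists_kill_solution_abc_final`),
and every classical solution in the class from the seed coincides with it on `[0, T]`. Composition of:
the X0 door backwards (`TransportGalerkinAbcEigen.exists_eigenData_of_isLinNSEigenvalue_abc`), the global
Galerkin levels (`TransportGalerkinLevelExistence.exists_level_solution`), the level bounds on the window
(`TransportGalerkinEmergenceLevels.exists_levelBound` / `TransportGalerkinKillLevels.levelBound_kill` —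
this is where the certificates enter), existence/uniqueness of the `C⁰`-limit in the class
(`TransportGalerkinExistence.exists_solution_of_levelBound` / `eqOn_of_solutions`), and the floor / decay
(`TransportGalerkinEmergenceH2.half_prediction_nsField_of_levelBound` / `decay_two_abc_final`). No
residence, box, radii, `H²`-bound or Galerkin datum among the hypotheses. Mathlib + the tree files
cited; no new definitions.
-/

noncomputable section

open scoped ENNReal NNReal ComplexConjugate InnerProductSpace
open Set Filter Topology

namespace Summit.NavierStokesRegularity.FluidComputer.TransportGalerkinAbcSolution

open RCLike MeasureTheory UnitAddTorus
open Literature.Analysis.FunctionSpaces Literature.Analysis.FunctionSpaces.Lattice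
open Literature.Analysis.FunctionSpaces.Torus Literature.Analysis.FunctionSpaces.EuclideanSpace
open Literature.Analysis.ODE Literature.Analysis.FluidPDE
open Summit.NavierStokesRegularity.FluidComputer.TransportGalerkin
open Summit.NavierStokesRegularity.FluidComputer.TransportGalerkinBox
open Summit.NavierStokesRegularity.FluidComputer.TransportGalerkinEigen
open Summit.NavierStokesRegularity.FluidComputer.TransportGalerkinAbc
open Summit.NavierStokesRegularity.FluidComputer.TransportGalerkinAbcEigen
open Summit.NavierStokesRegularity.FluidComputer.TransportGalerkinInvariance
open Summit.NavierStokesRegularity.FluidComputer.TransportGalerkinLevelSubspace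
open Summit.NavierStokesRegularity.FluidComputer.TransportGalerkinLevelExistence
open Summit.NavierStokesRegularity.FluidComputer.TransportGalerkinEmergenceH2
open Summit.NavierStokesRegularity.FluidComputer.TransportGalerkinEmergenceLevels
open Summit.NavierStokesRegularity.FluidComputer.TransportGalerkinKillLevels
open Summit.NavierStokesRegularity.FluidComputer.TransportGalerkinExistence
open Summit.NavierStokesRegularity.FluidComputer.TransportGalerkinAbcFinal
open Summit.NavierStokesRegularity.FluidComputer.TransportGalerkinAbcKillFinal
open Summit.NavierStokesRegularity.FluidComputer.ConvectiveProductLawBooking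

/-! ## §1 KEEP -/

set_option maxHeartbeats 400000 in
/-- **The forced-ABC KEEP word about THE solution** (`exists_keep_solution_abc_final`): from the X0 row
`Torus.IsLinNSEigenvalue ν (abcFlow A B C) μ` (`μ ≥ 0`, `ν > 0`) there is the door's eigenvector `v`, and
for EVERY window `T ≥ 0`, amplitude `ε > 0`, certificate objects/inequalities at levels `≥ K` (g18's list
verbatim), gap `ω < 2μ`, margin `C'` and window condition: there EXISTS a classical solution `w` of the
model on `[0, T]` from `ε•v` with a uniform polynomial tail of scaled order `6` and the three clauses, it
obeys `ε e^{μt}/2 ≤ ‖w t‖` while `ε e^{μt} ≤ 2/(9C')`, and every classical solution in the class from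
`ε•v` agrees with it on `[0, T]`. -/
theorem exists_keep_solution_abc_final (K : ℕ) (A B C : ℝ) {ν μ : ℝ} (hν : 0 < ν) (hμ : 0 ≤ μ)
    (heig : Torus.IsLinNSEigenvalue ν (Torus.abcFlow A B C) (μ : ℂ)) :
    ∃ v : lp (fun _ : (Fin 3 → ℤ) => EuclideanSpace ℂ (Fin 3)) 2,
      ‖v‖ = 1 ∧ RapidDecay (⇑v) ∧ (∀ k, lerayCLM k (v k) = v k) ∧
      (∀ (j : Fin 3) (k : Fin 3 → ℤ), (EuclideanSpace.proj j : EuclideanSpace ℂ (Fin 3) →L[ℂ] ℂ) (v (-k)) =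
        conj ((EuclideanSpace.proj j : EuclideanSpace ℂ (Fin 3) →L[ℂ] ℂ) (v k))) ∧
      (∀ k : Fin 3 → ℤ, ∑ j, ((k j : ℤ) : ℂ) * (EuclideanSpace.proj j : EuclideanSpace ℂ (Fin 3) →L[ℂ] ℂ) (v k) = 0) ∧
      linOp ν (mFourierCoeff (complexify ∘ Torus.abcFlow A B C))
          (fun j => (EuclideanSpace.proj j : EuclideanSpace ℂ (Fin 3) →L[ℂ] ℂ)) lerayCLM v = μ • v ∧
      ∀ {T : ℝ} (hT : 0 ≤ T) {ε : ℝ} (hε : 0 < ε)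
        {μt : ℝ}
        {G₁ G₂ G : lp (fun _ : (Fin 3 → ℤ) => EuclideanSpace ℂ (Fin 3)) 2 →L[ℝ]
          lp (fun _ : (Fin 3 → ℤ) => EuclideanSpace ℂ (Fin 3)) 2}
        (hG₁ : ∀ x y : lp (fun _ : (Fin 3 → ℤ) => EuclideanSpace ℂ (Fin 3)) 2, ⟪G₁ x, y⟫_ℂ = ⟪x, G₁ y⟫_ℂ)
        (hG₂ : ∀ x y : lp (fun _ : (Fin 3 → ℤ) => EuclideanSpace ℂ (Fin 3)) 2, ⟪G₂ x, y⟫_ℂ = ⟪x, G₂ y⟫_ℂ)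
        (hG : ∀ x y : lp (fun _ : (Fin 3 → ℤ) => EuclideanSpace ℂ (Fin 3)) 2, ⟪G x, y⟫_ℂ = ⟪x, G y⟫_ℂ)
        (hG₁P : ∀ n, ∀ w z : lp (fun _ : (Fin 3 → ℤ) => EuclideanSpace ℂ (Fin 3)) 2,
          ⟪G₁ w, cubeProj (n + K) z⟫_ℂ = ⟪G₁ (cubeProj (n + K) w), z⟫_ℂ)
        (hG₂P : ∀ n, ∀ w z : lp (fun _ : (Fin 3 → ℤ) => EuclideanSpace ℂ (Fin 3)) 2,
          ⟪G₂ w, cubeProj (n + K) z⟫_ℂ = ⟪G₂ (cubeProj (n + K) w), z⟫_ℂ)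
        (hGP : ∀ n, ∀ w z : lp (fun _ : (Fin 3 → ℤ) => EuclideanSpace ℂ (Fin 3)) 2,
          ⟪G w, cubeProj (n + K) z⟫_ℂ = ⟪G (cubeProj (n + K) w), z⟫_ℂ)
        (hG₁pos : ∀ x : lp (fun _ : (Fin 3 → ℤ) => EuclideanSpace ℂ (Fin 3)) 2, 0 ≤ re ⟪G₁ x, x⟫_ℂ)
        {ω c m₂ M₁ : ℝ} (hc : 0 < c) (hm₂ : 0 < m₂) (hM₁ : 0 ≤ M₁)
        (hm₂' : ∀ x : lp (fun _ : (Fin 3 → ℤ) => EuclideanSpace ℂ (Fin 3)) 2, m₂ * ‖x‖ ^ 2 ≤ re ⟪G₂ x, x⟫_ℂ)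
        (hM₁' : ∀ x : lp (fun _ : (Fin 3 → ℤ) => EuclideanSpace ℂ (Fin 3)) 2,
          re ⟪G₁ x, x⟫_ℂ ≤ M₁ * (eNormSq (-1) (⇑x)).toReal)
        {m M ω₁ : ℝ} (hm0 : 0 < m)
        (hm : ∀ x : lp (fun _ : (Fin 3 → ℤ) => EuclideanSpace ℂ (Fin 3)) 2, m * ‖x‖ ^ 2 ≤ re ⟪G x, x⟫_ℂ)
        (hM : ∀ x : lp (fun _ : (Fin 3 → ℤ) => EuclideanSpace ℂ (Fin 3)) 2, re ⟪G x, x⟫_ℂ ≤ M * ‖x‖ ^ 2)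
        (h₁ : ∀ n, ∀ w : lp (fun _ : (Fin 3 → ℤ) => EuclideanSpace ℂ (Fin 3)) 2,
          2 * re ⟪G₁ (cubeProj (n + K) w), linOp ν (mFourierCoeff (EuclideanSpace.complexify ∘ Torus.abcFlow A B C))
            (fun j => (EuclideanSpace.proj j : EuclideanSpace ℂ (Fin 3) →L[ℂ] ℂ)) lerayCLM (cubeProj (n + K) w)⟫_ℂ +
            c * re ⟪G₂ (cubeProj (n + K) w), cubeProj (n + K) w⟫_ℂ ≤ 2 * ω * re ⟪G₁ (cubeProj (n + K) w), cubeProj (n + K) w⟫_ℂ)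
        (h₂ : ∀ n, ∀ w : lp (fun _ : (Fin 3 → ℤ) => EuclideanSpace ℂ (Fin 3)) 2,
          re ⟪G₂ (cubeProj (n + K) w), linOp ν (mFourierCoeff (EuclideanSpace.complexify ∘ Torus.abcFlow A B C))
            (fun j => (EuclideanSpace.proj j : EuclideanSpace ℂ (Fin 3) →L[ℂ] ℂ)) lerayCLM (cubeProj (n + K) w)⟫_ℂ ≤
            ω * re ⟪G₂ (cubeProj (n + K) w), cubeProj (n + K) w⟫_ℂ)
        (hL : ∀ n, ∀ w : lp (fun _ : (Fin 3 → ℤ) => EuclideanSpace ℂ (Fin 3)) 2,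
          re ⟪G (cubeProj (n + K) w), linOp ν (mFourierCoeff (EuclideanSpace.complexify ∘ Torus.abcFlow A B C))
            (fun j => (EuclideanSpace.proj j : EuclideanSpace ℂ (Fin 3) →L[ℂ] ℂ)) lerayCLM (cubeProj (n + K) w)⟫_ℂ ≤
            ω₁ * re ⟪G (cubeProj (n + K) w), cubeProj (n + K) w⟫_ℂ)
        (hμ₁ : μt ≤ ω₁) (hμ₂ : μt ≤ ω)
        (htail : ∀ n, ∀ q : lp (fun _ : (Fin 3 → ℤ) => EuclideanSpace ℂ (Fin 3)) 2, cubeProj (n + K) q = 0 →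
          2 * μt * re ⟪G₁ q, q⟫_ℂ + c * re ⟪G₂ q, q⟫_ℂ ≤ 2 * ω * re ⟪G₁ q, q⟫_ℂ)
        (hgap : ω < 2 * μ)
        {C' : ℝ}
        (hCC' : Real.sqrt (M₁ / (c * m₂)) * (2 * ((Fintype.card (Fin 3) : ℝ) * (2 * Real.pi)) *
            Real.sqrt ((∑' l : Fin 3 → ℤ, ENNReal.ofReal (sobolevWeight (-2) l ^ 2)).toReal)) *
            Real.sqrt (Real.pi / (2 * μ - ω)) < C')
        (hsmall : ∀ t ∈ Icc 0 T, C' * (3 / 2 : ℝ) ^ 2 * (ε * Real.exp (μ * t)) < 3 / 2 - 1),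
        -- THE solution: existence in the class, the floor, uniqueness in the class
        ∃ w : ℝ → lp (fun _ : (Fin 3 → ℤ) => EuclideanSpace ℂ (Fin 3)) 2,
          ContinuousOn w (Icc 0 T) ∧ w 0 = ε • v ∧
          (∀ t ∈ Ioo 0 T, HasDerivAt w (nsField ν (mFourierCoeff (EuclideanSpace.complexify ∘ Torus.abcFlow A B C))
            (fun j => (EuclideanSpace.proj j : EuclideanSpace ℂ (Fin 3) →L[ℂ] ℂ)) lerayCLM (w t)) t) ∧
          (∃ Cw : ℝ, 0 ≤ Cw ∧ ∀ t ∈ Icc 0 T, ∀ k, ‖(w t : (Fin 3 → ℤ) → EuclideanSpace ℂ (Fin 3)) k‖ ≤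
            Cw * sobolevWeight (-((Fintype.card (Fin 3) : ℝ) + 3)) k) ∧
          (∀ t ∈ Icc 0 T, ∀ k, lerayCLM k ((w t : (Fin 3 → ℤ) → EuclideanSpace ℂ (Fin 3)) k) =
            (w t : (Fin 3 → ℤ) → EuclideanSpace ℂ (Fin 3)) k) ∧
          (∀ t ∈ Icc 0 T, ∀ (j : Fin 3) (k : Fin 3 → ℤ),
            (EuclideanSpace.proj j : EuclideanSpace ℂ (Fin 3) →L[ℂ] ℂ) ((w t : (Fin 3 → ℤ) → EuclideanSpace ℂ (Fin 3)) (-k)) =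
              conj ((EuclideanSpace.proj j : EuclideanSpace ℂ (Fin 3) →L[ℂ] ℂ) ((w t : (Fin 3 → ℤ) → EuclideanSpace ℂ (Fin 3)) k))) ∧
          (∀ t ∈ Icc 0 T, ∀ k : Fin 3 → ℤ,
            ∑ j, ((k j : ℤ) : ℂ) * (EuclideanSpace.proj j : EuclideanSpace ℂ (Fin 3) →L[ℂ] ℂ)
              ((w t : (Fin 3 → ℤ) → EuclideanSpace ℂ (Fin 3)) k) = 0) ∧
          (∀ t ∈ Icc 0 T, ε * Real.exp (μ * t) ≤ 2 / (9 * C') → ε * Real.exp (μ * t) / 2 ≤ ‖w t‖) ∧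
          ∀ {w' : ℝ → lp (fun _ : (Fin 3 → ℤ) => EuclideanSpace ℂ (Fin 3)) 2} (_hw' : ContinuousOn w' (Icc 0 T))
            (_hw'0 : w' 0 = ε • v)
            (_hw'' : ∀ t ∈ Ioo 0 T, HasDerivAt w' (nsField ν (mFourierCoeff (EuclideanSpace.complexify ∘ Torus.abcFlow A B C))
              (fun j => (EuclideanSpace.proj j : EuclideanSpace ℂ (Fin 3) →L[ℂ] ℂ)) lerayCLM (w' t)) t)
            {C'w : ℝ} (_hC'w : 0 ≤ C'w)
            (_hw'dec : ∀ t ∈ Icc 0 T, ∀ k, ‖(w' t : (Fin 3 → ℤ) → EuclideanSpace ℂ (Fin 3)) k‖ ≤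
              C'w * sobolevWeight (-((Fintype.card (Fin 3) : ℝ) + 3)) k)
            (_hw'fix : ∀ t ∈ Icc 0 T, ∀ k, lerayCLM k ((w' t : (Fin 3 → ℤ) → EuclideanSpace ℂ (Fin 3)) k) =
              (w' t : (Fin 3 → ℤ) → EuclideanSpace ℂ (Fin 3)) k)
            (_hw'real : ∀ t ∈ Icc 0 T, ∀ (j : Fin 3) (k : Fin 3 → ℤ),
              (EuclideanSpace.proj j : EuclideanSpace ℂ (Fin 3) →L[ℂ] ℂ) ((w' t : (Fin 3 → ℤ) → EuclideanSpace ℂ (Fin 3)) (-k)) =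
                conj ((EuclideanSpace.proj j : EuclideanSpace ℂ (Fin 3) →L[ℂ] ℂ) ((w' t : (Fin 3 → ℤ) → EuclideanSpace ℂ (Fin 3)) k)))
            (_hw'div : ∀ t ∈ Icc 0 T, ∀ k : Fin 3 → ℤ,
              ∑ j, ((k j : ℤ) : ℂ) * (EuclideanSpace.proj j : EuclideanSpace ℂ (Fin 3) →L[ℂ] ℂ)
                ((w' t : (Fin 3 → ℤ) → EuclideanSpace ℂ (Fin 3)) k) = 0),
            EqOn w' w (Icc 0 T) := by
  obtain ⟨v, hv1, hvr, hvP, hvreal, hvdiv, hAv, hres⟩ := exists_eigenData_of_isLinNSEigenvalue_abc A B C heig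
  refine ⟨v, hv1, hvr, hvP, hvreal, hvdiv, hAv, ?_⟩
  intro T hT ε hε μt G₁ G₂ G hG₁ hG₂ hG hG₁P hG₂P hGP hG₁pos ω c m₂ M₁ hc hm₂ hM₁ hm₂' hM₁' m M ω₁ hm0 hm hM h₁ h₂
    hL hμ₁ hμ₂ htail hgap C' hCC' hsmall
  -- the Galerkin levels of the seed: constructed (global existence + linear clauses)
  have hUreal : IsConjSymm (mFourierCoeff (EuclideanSpace.complexify ∘ Torus.abcFlow A B C)) :=
    (isConjSymm_iff_proj _).2 (abcHost_real A B C)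
  have hsol := fun n => exists_level_solution (ν := ν) hν.le (rapidDecay_abcHost A B C) hUreal (abcHost_div A B C)
    (n + K) (cubeProj_smul_mem_levelSubspace hvP hvreal hvdiv ε (n + K))
  choose u hu0 hu' hucont humem using hsol
  -- the chain's own `H²` bound on the window (the certificates enter here)
  obtain ⟨r, hr, hbound⟩ := exists_levelBound K (rapidDecay_abcHost A B C) TransportGalerkinAbc.norm_proj_le
    norm_lerayCLM_le (tsum_sobolevWeight_neg_two_sq_lt_top (Fintype.card_fin 3).le) hv1 hμ hε (u := u)
    (fun n t ht => (hu' n T t ht).continuousWithinAt) (fun n => hu0 n) (fun n t ht => hu' n T t ht)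
    (fun n => hucont n T) (fun n t _ => (humem n t).1)
    hG₁ hG₂ hG hG₁P hG₂P hGP hG₁pos hc hm₂ hM₁ hm₂' hM₁' hm0 hm hM h₁ h₂ hL hμ₁ hμ₂ htail hgap
    (hres.comp (tendsto_add_atTop_nat K)) hCC' hsmall
  -- the seed: rapidly decreasing and constrained
  have hzr : RapidDecay (⇑(ε • v)) := rapidDecay_coe_smul hvr ε
  have hzW := mem_box.1 (smul_mem_box (P := lerayCLM) hvP hvreal hvdiv (ε := ε) fun k => le_rfl)
  -- THE solution: existence in the class
  obtain ⟨w, -, hw, hw0, hw', ⟨Cw, hCw, hwdec⟩, hwfix, hwreal, hwdiv⟩ :=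
    exists_solution_of_levelBound K hν (rapidDecay_abcHost A B C) (abcHost_real A B C) (abcHost_div A B C)
      TransportGalerkinAbc.norm_proj_le isSelfAdjoint_lerayCLM norm_lerayCLM_le
      (tsum_sobolevWeight_neg_two_sq_lt_top (Fintype.card_fin 3).le) hT hzr hzW.2.1 hzW.2.2.1 hzW.2.2.2 hr
      (u := u) (fun n t ht => (hu' n T t ht).continuousWithinAt) (fun n => hu0 n) (fun n t ht => hu' n T t ht)
      (fun n t _ => (humem n t).1) (fun n t _ => (humem n t).2.1) (fun n t _ => (humem n t).2.2.1)
      (fun n t _ => (humem n t).2.2.2) hbound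
  refine ⟨w, hw, hw0, hw', ⟨Cw, hCw, hwdec⟩, hwfix, hwreal, hwdiv, fun t ht hχ => ?_, ?_⟩
  · -- the floor
    exact half_prediction_nsField_of_levelBound K hν (rapidDecay_abcHost A B C) (abcHost_real A B C)
      (abcHost_div A B C) TransportGalerkinAbc.norm_proj_le isSelfAdjoint_lerayCLM norm_lerayCLM_le
      (tsum_sobolevWeight_neg_two_sq_lt_top (Fintype.card_fin 3).le) hT hv1 hvr hvP hvreal hvdiv hμ hε hr
      (u := u) (fun n t ht => (hu' n T t ht).continuousWithinAt) (fun n => hu0 n) (fun n t ht => hu' n T t ht)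
      (fun n t _ => (humem n t).1) (fun n t _ => (humem n t).2.1) (fun n t _ => (humem n t).2.2.1)
      (fun n t _ => (humem n t).2.2.2) hbound hG₁ hG₂ hG hG₁P hG₂P hGP hG₁pos hc hm₂ hM₁ hm₂' hM₁' hm0 hm hM
      h₁ h₂ hL hμ₁ hμ₂ htail hgap (hres.comp (tendsto_add_atTop_nat K)) hCC' hsmall hw hw0 hw' hCw hwdec hwfix
      hwreal hwdiv ht hχ
  · -- uniqueness in the class
    intro w' hw'c hw'0 hw'' C'w hC'w hw'dec hw'fix hw'real hw'div
    exact eqOn_of_solutions K hν (rapidDecay_abcHost A B C) (abcHost_real A B C) (abcHost_div A B C)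
      TransportGalerkinAbc.norm_proj_le isSelfAdjoint_lerayCLM norm_lerayCLM_le
      (tsum_sobolevWeight_neg_two_sq_lt_top (Fintype.card_fin 3).le) hT hzr hzW.2.1 hzW.2.2.1 hzW.2.2.2 hr
      (u := u) (fun n t ht => (hu' n T t ht).continuousWithinAt) (fun n => hu0 n) (fun n t ht => hu' n T t ht)
      (fun n t _ => (humem n t).1) (fun n t _ => (humem n t).2.1) (fun n t _ => (humem n t).2.2.1)
      (fun n t _ => (humem n t).2.2.2) hbound hw'c hw'0 hw'' hC'w hw'dec hw'fix hw'real hw'div hw hw0 hw' hCw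
      hwdec hwfix hwreal hwdiv

/-! ## §2 KILL -/

/-- **The forced-ABC KILL word about THE solution** (`exists_kill_solution_abc_final`): from `ν > 0`,
`T ≥ 0`, a rapidly decreasing constrained seed `x`, the certificate objects/inequalities at levels `≥ K`
(g18's list verbatim), the rate block (`ω < 2λ ≤ 0`, `ω₁ ≤ λ`) and the basin data (`√(M/m)‖x‖ < ε`,
`4Cε < 1`): there EXISTS a classical solution `w` of the model on `[0, T]` from `x` with a uniform
polynomial tail of scaled order `6` and the three clauses, it obeys `‖w t‖ ≤ 2 ε e^{λt}` on `[0, T]`, and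
every classical solution in the class from `x` agrees with it on `[0, T]`. -/
theorem exists_kill_solution_abc_final (K : ℕ) (A B C : ℝ) {ν : ℝ} (hν : 0 < ν) {T : ℝ} (hT : 0 ≤ T)
    {x : lp (fun _ : (Fin 3 → ℤ) => EuclideanSpace ℂ (Fin 3)) 2} (hxr : RapidDecay (⇑x))
    (hxfix : ∀ k, lerayCLM k (x k) = x k)
    (hxreal : ∀ (j : Fin 3) (k : Fin 3 → ℤ), (EuclideanSpace.proj j : EuclideanSpace ℂ (Fin 3) →L[ℂ] ℂ) (x (-k)) =
      conj ((EuclideanSpace.proj j : EuclideanSpace ℂ (Fin 3) →L[ℂ] ℂ) (x k)))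
    (hxdiv : ∀ k : Fin 3 → ℤ, ∑ j, ((k j : ℤ) : ℂ) * (EuclideanSpace.proj j : EuclideanSpace ℂ (Fin 3) →L[ℂ] ℂ) (x k) = 0)
    {μt : ℝ}
    {G₁ G₂ G : lp (fun _ : (Fin 3 → ℤ) => EuclideanSpace ℂ (Fin 3)) 2 →L[ℝ]
      lp (fun _ : (Fin 3 → ℤ) => EuclideanSpace ℂ (Fin 3)) 2}
    (hG₁ : ∀ x y : lp (fun _ : (Fin 3 → ℤ) => EuclideanSpace ℂ (Fin 3)) 2, ⟪G₁ x, y⟫_ℂ = ⟪x, G₁ y⟫_ℂ)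
    (hG₂ : ∀ x y : lp (fun _ : (Fin 3 → ℤ) => EuclideanSpace ℂ (Fin 3)) 2, ⟪G₂ x, y⟫_ℂ = ⟪x, G₂ y⟫_ℂ)
    (hG : ∀ x y : lp (fun _ : (Fin 3 → ℤ) => EuclideanSpace ℂ (Fin 3)) 2, ⟪G x, y⟫_ℂ = ⟪x, G y⟫_ℂ)
    (hG₁P : ∀ n, ∀ w z : lp (fun _ : (Fin 3 → ℤ) => EuclideanSpace ℂ (Fin 3)) 2,
      ⟪G₁ w, cubeProj (n + K) z⟫_ℂ = ⟪G₁ (cubeProj (n + K) w), z⟫_ℂ)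
    (hG₂P : ∀ n, ∀ w z : lp (fun _ : (Fin 3 → ℤ) => EuclideanSpace ℂ (Fin 3)) 2,
      ⟪G₂ w, cubeProj (n + K) z⟫_ℂ = ⟪G₂ (cubeProj (n + K) w), z⟫_ℂ)
    (hGP : ∀ n, ∀ w z : lp (fun _ : (Fin 3 → ℤ) => EuclideanSpace ℂ (Fin 3)) 2,
      ⟪G w, cubeProj (n + K) z⟫_ℂ = ⟪G (cubeProj (n + K) w), z⟫_ℂ)
    (hG₁pos : ∀ x : lp (fun _ : (Fin 3 → ℤ) => EuclideanSpace ℂ (Fin 3)) 2, 0 ≤ re ⟪G₁ x, x⟫_ℂ)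
    {ω c m₂ M₁ : ℝ} (hc : 0 < c) (hm₂ : 0 < m₂) (hM₁ : 0 ≤ M₁)
    (hm₂' : ∀ x : lp (fun _ : (Fin 3 → ℤ) => EuclideanSpace ℂ (Fin 3)) 2, m₂ * ‖x‖ ^ 2 ≤ re ⟪G₂ x, x⟫_ℂ)
    (hM₁' : ∀ x : lp (fun _ : (Fin 3 → ℤ) => EuclideanSpace ℂ (Fin 3)) 2,
      re ⟪G₁ x, x⟫_ℂ ≤ M₁ * (eNormSq (-1) (⇑x)).toReal)
    {m M ω₁ : ℝ} (hm0 : 0 < m)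
    (hm : ∀ x : lp (fun _ : (Fin 3 → ℤ) => EuclideanSpace ℂ (Fin 3)) 2, m * ‖x‖ ^ 2 ≤ re ⟪G x, x⟫_ℂ)
    (hM : ∀ x : lp (fun _ : (Fin 3 → ℤ) => EuclideanSpace ℂ (Fin 3)) 2, re ⟪G x, x⟫_ℂ ≤ M * ‖x‖ ^ 2)
    (h₁ : ∀ n, ∀ w : lp (fun _ : (Fin 3 → ℤ) => EuclideanSpace ℂ (Fin 3)) 2,
      2 * re ⟪G₁ (cubeProj (n + K) w), linOp ν (mFourierCoeff (EuclideanSpace.complexify ∘ Torus.abcFlow A B C))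
        (fun j => (EuclideanSpace.proj j : EuclideanSpace ℂ (Fin 3) →L[ℂ] ℂ)) lerayCLM (cubeProj (n + K) w)⟫_ℂ +
        c * re ⟪G₂ (cubeProj (n + K) w), cubeProj (n + K) w⟫_ℂ ≤ 2 * ω * re ⟪G₁ (cubeProj (n + K) w), cubeProj (n + K) w⟫_ℂ)
    (h₂ : ∀ n, ∀ w : lp (fun _ : (Fin 3 → ℤ) => EuclideanSpace ℂ (Fin 3)) 2,
      re ⟪G₂ (cubeProj (n + K) w), linOp ν (mFourierCoeff (EuclideanSpace.complexify ∘ Torus.abcFlow A B C))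
        (fun j => (EuclideanSpace.proj j : EuclideanSpace ℂ (Fin 3) →L[ℂ] ℂ)) lerayCLM (cubeProj (n + K) w)⟫_ℂ ≤
        ω * re ⟪G₂ (cubeProj (n + K) w), cubeProj (n + K) w⟫_ℂ)
    (hL : ∀ n, ∀ w : lp (fun _ : (Fin 3 → ℤ) => EuclideanSpace ℂ (Fin 3)) 2,
      re ⟪G (cubeProj (n + K) w), linOp ν (mFourierCoeff (EuclideanSpace.complexify ∘ Torus.abcFlow A B C))
        (fun j => (EuclideanSpace.proj j : EuclideanSpace ℂ (Fin 3) →L[ℂ] ℂ)) lerayCLM (cubeProj (n + K) w)⟫_ℂ ≤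
        ω₁ * re ⟪G (cubeProj (n + K) w), cubeProj (n + K) w⟫_ℂ)
    (hμ₁ : μt ≤ ω₁) (hμ₂ : μt ≤ ω)
    (htail : ∀ n, ∀ q : lp (fun _ : (Fin 3 → ℤ) => EuclideanSpace ℂ (Fin 3)) 2, cubeProj (n + K) q = 0 →
      2 * μt * re ⟪G₁ q, q⟫_ℂ + c * re ⟪G₂ q, q⟫_ℂ ≤ 2 * ω * re ⟪G₁ q, q⟫_ℂ)
    {lam : ℝ} (hgap : ω < 2 * lam) (hlam : lam ≤ 0) (hrate : ω₁ ≤ lam)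
    {ε : ℝ} (hε : 0 < ε) (hseed : Real.sqrt (M / m) * ‖x‖ < ε)
    (hbasin : 4 * (Real.sqrt (M₁ / (c * m₂)) * (2 * ((Fintype.card (Fin 3) : ℝ) * (2 * Real.pi)) *
        Real.sqrt ((∑' l : Fin 3 → ℤ, ENNReal.ofReal (sobolevWeight (-2) l ^ 2)).toReal)) *
        Real.sqrt (Real.pi / (2 * lam - ω))) * ε < 1) :
    -- THE solution: existence in the class, the decay, uniqueness in the class
    ∃ w : ℝ → lp (fun _ : (Fin 3 → ℤ) => EuclideanSpace ℂ (Fin 3)) 2,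
      ContinuousOn w (Icc 0 T) ∧ w 0 = x ∧
      (∀ t ∈ Ioo 0 T, HasDerivAt w (nsField ν (mFourierCoeff (EuclideanSpace.complexify ∘ Torus.abcFlow A B C))
        (fun j => (EuclideanSpace.proj j : EuclideanSpace ℂ (Fin 3) →L[ℂ] ℂ)) lerayCLM (w t)) t) ∧
      (∃ Cw : ℝ, 0 ≤ Cw ∧ ∀ t ∈ Icc 0 T, ∀ k, ‖(w t : (Fin 3 → ℤ) → EuclideanSpace ℂ (Fin 3)) k‖ ≤
        Cw * sobolevWeight (-((Fintype.card (Fin 3) : ℝ) + 3)) k) ∧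
      (∀ t ∈ Icc 0 T, ∀ k, lerayCLM k ((w t : (Fin 3 → ℤ) → EuclideanSpace ℂ (Fin 3)) k) =
        (w t : (Fin 3 → ℤ) → EuclideanSpace ℂ (Fin 3)) k) ∧
      (∀ t ∈ Icc 0 T, ∀ (j : Fin 3) (k : Fin 3 → ℤ),
        (EuclideanSpace.proj j : EuclideanSpace ℂ (Fin 3) →L[ℂ] ℂ) ((w t : (Fin 3 → ℤ) → EuclideanSpace ℂ (Fin 3)) (-k)) =
          conj ((EuclideanSpace.proj j : EuclideanSpace ℂ (Fin 3) →L[ℂ] ℂ) ((w t : (Fin 3 → ℤ) → EuclideanSpace ℂ (Fin 3)) k))) ∧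
      (∀ t ∈ Icc 0 T, ∀ k : Fin 3 → ℤ,
        ∑ j, ((k j : ℤ) : ℂ) * (EuclideanSpace.proj j : EuclideanSpace ℂ (Fin 3) →L[ℂ] ℂ)
          ((w t : (Fin 3 → ℤ) → EuclideanSpace ℂ (Fin 3)) k) = 0) ∧
      (∀ t ∈ Icc 0 T, ‖w t‖ ≤ 2 * (ε * Real.exp (lam * t))) ∧
      ∀ {w' : ℝ → lp (fun _ : (Fin 3 → ℤ) => EuclideanSpace ℂ (Fin 3)) 2} (_hw' : ContinuousOn w' (Icc 0 T))
        (_hw'0 : w' 0 = x)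
        (_hw'' : ∀ t ∈ Ioo 0 T, HasDerivAt w' (nsField ν (mFourierCoeff (EuclideanSpace.complexify ∘ Torus.abcFlow A B C))
          (fun j => (EuclideanSpace.proj j : EuclideanSpace ℂ (Fin 3) →L[ℂ] ℂ)) lerayCLM (w' t)) t)
        {C'w : ℝ} (_hC'w : 0 ≤ C'w)
        (_hw'dec : ∀ t ∈ Icc 0 T, ∀ k, ‖(w' t : (Fin 3 → ℤ) → EuclideanSpace ℂ (Fin 3)) k‖ ≤
          C'w * sobolevWeight (-((Fintype.card (Fin 3) : ℝ) + 3)) k)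
        (_hw'fix : ∀ t ∈ Icc 0 T, ∀ k, lerayCLM k ((w' t : (Fin 3 → ℤ) → EuclideanSpace ℂ (Fin 3)) k) =
          (w' t : (Fin 3 → ℤ) → EuclideanSpace ℂ (Fin 3)) k)
        (_hw'real : ∀ t ∈ Icc 0 T, ∀ (j : Fin 3) (k : Fin 3 → ℤ),
          (EuclideanSpace.proj j : EuclideanSpace ℂ (Fin 3) →L[ℂ] ℂ) ((w' t : (Fin 3 → ℤ) → EuclideanSpace ℂ (Fin 3)) (-k)) =
            conj ((EuclideanSpace.proj j : EuclideanSpace ℂ (Fin 3) →L[ℂ] ℂ) ((w' t : (Fin 3 → ℤ) → EuclideanSpace ℂ (Fin 3)) k)))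
        (_hw'div : ∀ t ∈ Icc 0 T, ∀ k : Fin 3 → ℤ,
          ∑ j, ((k j : ℤ) : ℂ) * (EuclideanSpace.proj j : EuclideanSpace ℂ (Fin 3) →L[ℂ] ℂ)
            ((w' t : (Fin 3 → ℤ) → EuclideanSpace ℂ (Fin 3)) k) = 0),
        EqOn w' w (Icc 0 T) := by
  -- the Galerkin levels of the seed: constructed
  have hUreal : IsConjSymm (mFourierCoeff (EuclideanSpace.complexify ∘ Torus.abcFlow A B C)) :=
    (isConjSymm_iff_proj _).2 (abcHost_real A B C)
  have hxS : ∀ N, cubeProj N x ∈ levelSubspace N := fun N => by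
    have hz : x ∈ box (fun k => ‖(x : (Fin 3 → ℤ) → EuclideanSpace ℂ (Fin 3)) k‖)
        (fun j => (EuclideanSpace.proj j : EuclideanSpace ℂ (Fin 3) →L[ℂ] ℂ)) lerayCLM :=
      mem_box.2 ⟨fun k => le_rfl, hxfix, hxreal, hxdiv⟩
    have h := cubeProj_mem_box hz N
    exact ⟨lpProj_idem _ _, h.2.1, h.2.2.1, h.2.2.2⟩
  have hsol := fun n => exists_level_solution (ν := ν) hν.le (rapidDecay_abcHost A B C) hUreal (abcHost_div A B C)
    (n + K) (hxS (n + K))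
  choose u hu0 hu' hucont humem using hsol
  -- the KILL ceiling at every level (the certificates enter here): `‖u n t‖ ≤ 2 ε e^{λt} ≤ 2 ε`
  have hbound : ∀ n, ∀ t ∈ Icc 0 T, ‖u n t‖ ≤ 2 * ε := by
    intro n t ht
    have h := levelBound_kill K (rapidDecay_abcHost A B C) TransportGalerkinAbc.norm_proj_le norm_lerayCLM_le
      (tsum_sobolevWeight_neg_two_sq_lt_top (Fintype.card_fin 3).le) (u := u)
      (fun n t ht => (hu' n T t ht).continuousWithinAt) (fun n => hu0 n) (fun n t ht => hu' n T t ht)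
      (fun n => hucont n T) (fun n t _ => (humem n t).1)
      hG₁ hG₂ hG hG₁P hG₂P hGP hG₁pos hc hm₂ hM₁ hm₂' hM₁' hm0 hm hM h₁ h₂ hL hμ₁ hμ₂ htail hgap hlam hrate hε
      hseed hbasin n t ht
    have hexp : Real.exp (lam * t) ≤ 1 := by
      rw [← Real.exp_zero]; exact Real.exp_le_exp.2 (mul_nonpos_of_nonpos_of_nonneg hlam ht.1)
    nlinarith [h, hexp, hε]
  -- THE solution: existence in the class
  obtain ⟨w, -, hw, hw0, hw', ⟨Cw, hCw, hwdec⟩, hwfix, hwreal, hwdiv⟩ :=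
    exists_solution_of_levelBound K hν (rapidDecay_abcHost A B C) (abcHost_real A B C) (abcHost_div A B C)
      TransportGalerkinAbc.norm_proj_le isSelfAdjoint_lerayCLM norm_lerayCLM_le
      (tsum_sobolevWeight_neg_two_sq_lt_top (Fintype.card_fin 3).le) hT hxr hxfix hxreal hxdiv
      (by positivity : (0 : ℝ) < 2 * ε)
      (u := u) (fun n t ht => (hu' n T t ht).continuousWithinAt) (fun n => hu0 n) (fun n t ht => hu' n T t ht)
      (fun n t _ => (humem n t).1) (fun n t _ => (humem n t).2.1) (fun n t _ => (humem n t).2.2.1)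
      (fun n t _ => (humem n t).2.2.2) hbound
  refine ⟨w, hw, hw0, hw', ⟨Cw, hCw, hwdec⟩, hwfix, hwreal, hwdiv, ?_, ?_⟩
  · -- the decay
    exact decay_two_abc_final K A B C hν hT hxr hxfix hxreal hxdiv hG₁ hG₂ hG hG₁P hG₂P hGP hG₁pos hc hm₂ hM₁
      hm₂' hM₁' hm0 hm hM h₁ h₂ hL hμ₁ hμ₂ htail hgap hlam hrate hε hseed hbasin hw hw0 hw' hCw hwdec hwfix
      hwreal hwdiv
  · -- uniqueness in the class
    intro w' hw'c hw'0 hw'' C'w hC'w hw'dec hw'fix hw'real hw'div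
    exact eqOn_of_solutions K hν (rapidDecay_abcHost A B C) (abcHost_real A B C) (abcHost_div A B C)
      TransportGalerkinAbc.norm_proj_le isSelfAdjoint_lerayCLM norm_lerayCLM_le
      (tsum_sobolevWeight_neg_two_sq_lt_top (Fintype.card_fin 3).le) hT hxr hxfix hxreal hxdiv
      (by positivity : (0 : ℝ) < 2 * ε)
      (u := u) (fun n t ht => (hu' n T t ht).continuousWithinAt) (fun n => hu0 n) (fun n t ht => hu' n T t ht)
      (fun n t _ => (humem n t).1) (fun n t _ => (humem n t).2.1) (fun n t _ => (humem n t).2.2.1)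
      (fun n t _ => (humem n t).2.2.2) hbound hw'c hw'0 hw'' hC'w hw'dec hw'fix hw'real hw'div hw hw0 hw' hCw
      hwdec hwfix hwreal hwdiv

end Summit.NavierStokesRegularity.FluidComputer.TransportGalerkinAbcSolution

end
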